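import Literature.Analysis.FluidPDE.AlexakisDoering
import Literature.Analysis.FluidPDE.AlexakisDoeringProofs
import Literature.Analysis.FluidPDE.AlexakisDoeringEnstrophyDissipationHolds
import HarnessLib

/-!
# Discharge of `alexakis_doering_enstrophy_bound` (turb.S25, Alexakis–Doering's `χ ≤ U³k_f³(C₁ + C₂/Re)`)

Trunk: FluidKinetic (`Literature/Analysis/FluidPDE`). Sibling proof file of
`Literature.Analysis.FluidPDE.ZerothLaw`: the named fact
`Literature.Analysis.FluidPDE.alexakis_doering_enstrophy_bound` (Alexakis–Doering, *Energy and
enstrophy dissipation in steady state 2d turbulence*, Phys. Lett. A 359 (2006) 652–657 =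
arXiv:physics/0605090, §2, eq. (19) / display "(Xbound)": "we can choose `v` appropriately and
use (F1a) to eliminate `F` in (VBI) so that `χ ≤ U³k_f³(C₁ + C₂/Re)`", for every global
Leray–Hopf solution of the 2-D Navier–Stokes equations on the unit torus driven by the steady
force `F Φ(n • x)` (`ℓ = 1/n`) with smooth datum and `U > 0`) is now a theorem.

The reduction `alexakis_doering_enstrophy_bound_of` (`AlexakisDoering`; the algebra of
"(Xbound)", `c₁ = a a'`, `c₂ = a b'`) takes the two displayed inputs of §2 as named facts, and
both have been discharged in the tree:

* "(VBI)" / arXiv eq. (16), `χ ≤ k_f² U F`: `AlexakisDoering2006_enstrophyDissipation_le_holds`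
  (`AlexakisDoeringEnstrophyDissipationHolds`: averaged enstrophy inequality of every 2-D
  Leray–Hopf solution with smooth datum, via the Galerkin scheme with the enstrophy inequality and
  the discharged Lions–Prodi uniqueness theorem `lions_prodi_uniqueness_torus2_holds`);
* "(F1a)" / arXiv eq. (18), `|F| ≤ a U²/ℓ + b ν U/ℓ²`: `AlexakisDoering2006_amplitude_le_holds`
  (`AlexakisDoeringProofs`: the weak formulation tested with the multiplier `Φ(n • ·)`, proved
  unconditionally for Leray–Hopf solutions on `T^d`).

This file only assembles them; it cannot live in `ZerothLaw` or `ZerothLawProofs` themselves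
(both are imported by `AlexakisDoeringProofs`). Axioms `propext`, `Classical.choice`,
`Quot.sound` only. Nothing else is here: the energy-dissipation corollary
`ε ≤ k_f U³ Re^{-1/2}(C₁ + C₂/Re)^{1/2}` (§2, last two displays) is assembled next to the barrier
it serves, `Literature.Barriers.AnomalousDissipation.TwoDimensionalEnergyDissipationProofs`.

## References

* A. Alexakis, C. R. Doering, *Energy and enstrophy dissipation in steady state 2d turbulence*,
  Phys. Lett. A 359 (2006), 652–657, §2, eq. (19) / display (Xbound) (arXiv:physics/0605090).
  [AlexakisDoering2006PLA]
* C. Foias, O. Manley, R. Rosa, R. Temam, *Navier–Stokes Equations and Turbulence*, CUP 2001,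
  Ch. II Thm. 7.3–7.4 (the 2-D theory behind "(VBI)"). [FoiasManleyRosaTemam2001]
-/

noncomputable section

namespace Literature.Analysis.FluidPDE

/-- **turb.S25, Alexakis–Doering's enstrophy dissipation bound, discharged** (Alexakis–Doering,
Phys. Lett. A 359 (2006), §2, eq. (19) / display "(Xbound)": `χ ≤ U³k_f³(C₁ + C₂/Re)`, "where
the dimensionless coefficients `C₁` and `C₂` are independent of `k_f` and `L`, depending only on
the functional shape of `v` (and thus also on the shape of `f`) but not on its amplitude `F` or
the viscosity `ν`"): the named fact `alexakis_doering_enstrophy_bound` of `ZerothLaw` holds — for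
every forcing shape `Φ` on `T²` there are `c₁, c₂ > 0` such that every global Leray–Hopf
solution on `T²` driven by `F Φ(n • x)` (`ℓ = 1/n`, `n ∈ ℕ⁺`), `ν > 0`, smooth datum,
`U = ⟨‖u‖₂²⟩^{1/2} > 0`, has `χ = ν⟨‖Δu‖₂²⟩ ≤ c₁ U³/ℓ³ + c₂ ν U²/ℓ⁴`. It is the proved reduction
`alexakis_doering_enstrophy_bound_of` fed with the discharged steps "(VBI)"
(`AlexakisDoering2006_enstrophyDissipation_le_holds`) and "(F1a)"
(`AlexakisDoering2006_amplitude_le_holds`); the constants are `c₁ = a a'`, `c₂ = a b'` with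
`a = ‖ΔΦ‖_∞ + 1`, `a' = ‖∑ᵢ‖∂ᵢΦ‖‖_∞ + 1`, `b' = ‖ΔΦ‖_∞ + 1`. [cite: AlexakisDoering2006PLA, §2 eq. (19) / display (Xbound)] -/
theorem alexakis_doering_enstrophy_bound_holds : alexakis_doering_enstrophy_bound :=
  alexakis_doering_enstrophy_bound_of AlexakisDoering2006_enstrophyDissipation_le_holds
    AlexakisDoering2006_amplitude_le_holds

end Literature.Analysis.FluidPDE

end
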